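import Summits.ValiantsHypothesis.ValiantsHypothesis.Theorems.BarrierLeverChowBenchmarkPairsSplitCertHomog
import Summits.ValiantsHypothesis.ValiantsHypothesis.Theorems.BarrierLeverChowBenchmarkPairsTranslation
import Summits.ValiantsHypothesis.ValiantsHypothesis.Theorems.BarrierLeverChowBenchmarkPairsDualisation

/-!
# Route BarrierLever — item 22038 `ChowBenchmarkPairs`, line `moore-peel`: SPLIT CERTIFICATES — the TYPED NODE «every enumeration has a
# split certificate for its homogeneous root» and its KERNEL ARROW to the registered stub `stub_segmentMeanValue`

Helper file (`--supports stmt-ValiantsHypothesis-22038`; cell valiant-natproofs, rung V4; seat val-np-p4 gen 24).  Closes NO item.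

This completes slot #7 of the line's registry (planner mandate p4 g24, STATUS l.1440): a node each of whose instances is a FINITE SEARCH
(a list of levels accepted by the kernel checker `Cert.check` of `…SplitCertDefs`), with a kernel-checked arrow to `∀ h, SegmentMeanValueAt h`.

* `hS S` / `hw S` — the HOMOGENEOUS row of a set `S ⊆ Fin h` of size ≤ 2 over the points `Fin (h+1)` (`0` = the origin, `a ↦ a+1`):
  `∅ ↦ ({0}, 2)` (`R_0²`), `{a} ↦ ({0, a+1}, 1)` (`R_0R_a`), `{a,b} ↦ ({a+1, b+1}, 1)`; total weight always `2` (`sum_hw`).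
* `hom_entry_zero` — at a table with `P_0 = 0` the homogeneous entry IS the segment-moment entry `segE (P ∘ succ) S T` (point lemmas
  `dirE_singleton`, `dirE_pair_null`, `dirE_map_emb`).
* **`smv_of_hom`** — homogeneous nonsingularity ⇒ `SegmentMeanValueAt` nonsingularity FOR THE SAME ENUMERATION: translate the origin to `0`
  (`…Translation.det_shiftT`, total weight `2`, columns = the first `r ≤ 2^h` codes), then `hom_entry_zero`.
* `hEncL` / `hWL` — the list encoding of the homogeneous root of an enumeration `u`; `rootInstW_hEncL_matrix` — its instance matrix
  (`…SplitCertHomog.rootInstW_matrix`) is the homogeneous matrix `homMatrix u`.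
* **NODE `Stmt.splitCertH`**: for every `h` and every injective enumeration `u` of the subsets of `Fin h` of size ≤ 2, SOME list of levels
  passes `Cert.check h r · (rootInstW (hEncL u) (hWL u) r)`.  **ARROWS**: `smv_of_check` (one certificate ⇒ the `SegmentMeanValueAt`
  conclusion for that enumeration) and **`segmentMeanValue_of_splitCertH : Stmt.splitCertH → ∀ h, SegmentMeanValueAt h`** (verbatim,
  as `…ChowBenchmarkPairsHaar.segmentMeanValue_of_haar`).
EVIDENCE for the node: kernel-checked certificates for the canonical enumeration at every `h ≤ 10` (`…SplitCertInstancesA`, `HSMVAt h`;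
`h = 11, 12` in `…B`), val-np-p4 g23's top-only triangular certificates in the same model at every `h ≤ 31` (kit j314566/j314779/j315456);
«Conjecture C» of memo g23 §13.  HONESTLY STRONGER than `stub_segmentMeanValue` (it asserts certificates of a specific shape).  CHEAPEST
FALSIFIER: a height at which an exhaustive search over vertex orders / coordinates finds no certificate.

WHAT THIS IS NOT: the node is a typed CONJECTURE; no stub of the line is closed; nothing on crux stmt-ValiantsHypothesis-14610 or on
`VP` versus `VNP`.
-/

set_option linter.dupNamespace false
set_option autoImplicit false

namespace Summit.ValiantsHypothesis.ValiantsHypothesis.Theorems.BarrierLever.ChowBenchmarkSplit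

open Finset
open Literature.Computability.Complexity (getD_ofFn)
open Summit.ValiantsHypothesis.ValiantsHypothesis.Theorems.BarrierLever.MoorePeel (benchCols windowStart windowStart_succ_le_two_pow)
open Summit.ValiantsHypothesis.ValiantsHypothesis.Theorems.BarrierLever.ChowBenchmarkPeel (segE)
open Summit.ValiantsHypothesis.ValiantsHypothesis.Theorems.BarrierLever.ChowBenchmarkDual (eq_windowStart_of_enumeration)

section PointLemmas

variable {κ : Type*} [DecidableEq κ] {R : Type*} [CommRing R] {π : Type*} [DecidableEq π]

omit [DecidableEq κ] in
/-- The weight factor of a CONSTANT map `g ≡ y` into a row `S ∋ y`: `(w y)^{(|T|)}` (all other fibres are empty). -/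
theorem weight_const {S : Finset π} {T : Finset κ} (w : π → ℕ) {y : π} (hy : y ∈ S) :
    (∏ a : ↥S, (((w a).ascFactorial (Finset.univ.filter fun c : ↥T => (fun _ => (⟨y, hy⟩ : ↥S)) c = a).card : ℕ) : R)) =
      (((w y).ascFactorial T.card : ℕ) : R) := by
  rw [Finset.prod_eq_single (⟨y, hy⟩ : ↥S)]
  · have : (Finset.univ.filter fun c : ↥T => (fun _ => (⟨y, hy⟩ : ↥S)) c = ⟨y, hy⟩) = Finset.univ :=
      Finset.filter_true_of_mem fun _ _ => rfl
    rw [this, Finset.card_univ, Fintype.card_coe]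
  · intro a _ ha
    have : (Finset.univ.filter fun c : ↥T => (fun _ => (⟨y, hy⟩ : ↥S)) c = a) = ∅ :=
      Finset.filter_false_of_mem fun _ _ => fun e => ha e.symm
    rw [this, Finset.card_empty, Nat.ascFactorial_zero, Nat.cast_one]
  · intro h; exact absurd (Finset.mem_univ _) h

/-- A one-point row: `dirE P {y} w T = (w y)^{(|T|)} · ∏_{c∈T} P y c`. -/
theorem dirE_singleton (P : π → κ → R) (y : π) (w : π → ℕ) (T : Finset κ) :
    dirE P {y} w T = (((w y).ascFactorial T.card : ℕ) : R) * ∏ c ∈ T, P y c := by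
  unfold dirE
  have hy : y ∈ ({y} : Finset π) := Finset.mem_singleton_self y
  have huniq : ∀ g : ↥T → ↥({y} : Finset π), g = fun _ => ⟨y, hy⟩ :=
    fun g => funext fun c => Subtype.ext (Finset.mem_singleton.mp (g c).2)
  rw [Fintype.sum_eq_single (fun _ => (⟨y, hy⟩ : ↥({y} : Finset π))) (fun g hg => absurd (huniq g) hg), weight_const w hy,
    ← Finset.prod_coe_sort T (fun c => P y c), mul_comm]

/-- A two-point row whose first point is NULL on the column (`P x c = 0` for `c ∈ T`) is the one-point row of the other point. -/
theorem dirE_pair_null (P : π → κ → R) {x y : π} (w : π → ℕ) (T : Finset κ) (h0 : ∀ c ∈ T, P x c = 0) :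
    dirE P {x, y} w T = (((w y).ascFactorial T.card : ℕ) : R) * ∏ c ∈ T, P y c := by
  unfold dirE
  have hy : y ∈ ({x, y} : Finset π) := by simp
  rw [Fintype.sum_eq_single (fun _ => (⟨y, hy⟩ : ↥({x, y} : Finset π)))]
  · rw [weight_const w hy, ← Finset.prod_coe_sort T (fun c => P y c), mul_comm]
  · intro g hg
    obtain ⟨c, hc⟩ : ∃ c : ↥T, g c ≠ ⟨y, hy⟩ := by
      by_contra hall
      push Not at hall
      exact hg (funext hall)
    have hx : (g c : π) = x := by
      have := (g c).2
      simp only [Finset.mem_insert, Finset.mem_singleton] at this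
      rcases this with h | h
      · exact h
      · exact absurd (Subtype.ext h) hc
    have : (∏ c' : ↥T, P (g c') c') = 0 := Finset.prod_eq_zero (Finset.mem_univ c) (by rw [hx]; exact h0 _ c.2)
    rw [this, zero_mul]

/-- The points of `S.map e` are the points of `S`. -/
noncomputable def mapEquiv {π' : Type*} (e : π ↪ π') (S : Finset π) : ↥S ≃ ↥(S.map e) where
  toFun a := ⟨e a, Finset.mem_map_of_mem e a.2⟩
  invFun b := ⟨(Finset.mem_map.mp b.2).choose, (Finset.mem_map.mp b.2).choose_spec.1⟩
  left_inv a := by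
    apply Subtype.ext
    have h := (Finset.mem_map.mp (Finset.mem_map_of_mem e a.2)).choose_spec.2
    exact e.injective h
  right_inv b := by
    apply Subtype.ext
    exact (Finset.mem_map.mp b.2).choose_spec.2

/-- **Relabelling points along an embedding**: `dirE P' (S.map e) w T = dirE (P' ∘ e) S (w ∘ e) T`. -/
theorem dirE_map_emb {π' : Type*} [DecidableEq π'] (e : π ↪ π') (P' : π' → κ → R) (S : Finset π) (w : π' → ℕ) (T : Finset κ) :
    dirE P' (S.map e) w T = dirE (fun a => P' (e a)) S (fun a => w (e a)) T := by
  unfold dirE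
  symm
  refine Fintype.sum_equiv ((Equiv.refl ↥T).arrowCongr (mapEquiv e S)) _ _ fun g => ?_
  have hval : ∀ c : ↥T, ((Equiv.refl ↥T).arrowCongr (mapEquiv e S) g c) = mapEquiv e S (g c) := fun c => rfl
  have h1 : (∏ c : ↥T, P' (((Equiv.refl ↥T).arrowCongr (mapEquiv e S) g c : ↥(S.map e)) : π') c) =
      ∏ c : ↥T, P' (e (g c)) c := Finset.prod_congr rfl fun c _ => by rw [hval]; rfl
  have h2 : (∏ b : ↥(S.map e), (((w b).ascFactorial
      (Finset.univ.filter fun c : ↥T => (Equiv.refl ↥T).arrowCongr (mapEquiv e S) g c = b).card : ℕ) : R)) =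
      ∏ a : ↥S, (((w (e a)).ascFactorial (Finset.univ.filter fun c : ↥T => g c = a).card : ℕ) : R) := by
    refine (Fintype.prod_equiv (mapEquiv e S) _ _ fun a => ?_).symm
    have hfilter : (Finset.univ.filter fun c : ↥T => g c = a) =
        Finset.univ.filter fun c : ↥T => (Equiv.refl ↥T).arrowCongr (mapEquiv e S) g c = mapEquiv e S a := by
      refine Finset.filter_congr fun c _ => ?_
      rw [hval]
      exact ⟨fun h => by rw [h], fun h => (mapEquiv e S).injective h⟩
    rw [hfilter]
    rfl
  rw [h1, h2]

end PointLemmas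

end Summit.ValiantsHypothesis.ValiantsHypothesis.Theorems.BarrierLever.ChowBenchmarkSplit

namespace Summit.ValiantsHypothesis.ValiantsHypothesis.Theorems.BarrierLever.ChowBenchmarkSplit

open Finset
open Literature.Computability.Complexity (getD_ofFn)
open Summit.ValiantsHypothesis.ValiantsHypothesis.Theorems.BarrierLever.MoorePeel (benchCols windowStart windowStart_succ_le_two_pow)
open Summit.ValiantsHypothesis.ValiantsHypothesis.Theorems.BarrierLever.ChowBenchmarkPeel (segE)
open Summit.ValiantsHypothesis.ValiantsHypothesis.Theorems.BarrierLever.ChowBenchmarkDual (eq_windowStart_of_enumeration)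

/-! ## The homogeneous rows of an enumeration, and the specialisation `P_0 = 0` -/

section Hom

variable {h r : ℕ}

/-- **Homogeneous row** of a set `S ⊆ Fin h` of size ≤ 2, over the points `Fin (h+1)` (`0` = the origin, `a ↦ a+1`):
`∅ ↦ {0}`, `{a} ↦ {0, a+1}`, `{a,b} ↦ {a+1, b+1}`. -/
def hS (S : Finset (Fin h)) : Finset (Fin (h + 1)) :=
  if S.card ≤ 1 then insert 0 (S.map (Fin.succEmb h)) else S.map (Fin.succEmb h)

/-- **Homogeneous weight** of a set: `2` for `∅` (the row `R_0²`), `1` otherwise — total weight `2` in every case. -/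
def hw (S : Finset (Fin h)) : Fin (h + 1) → ℕ := fun _ => if S.card = 0 then 2 else 1

/-- `0` is not a successor. -/
theorem zero_not_mem_map_succ (S : Finset (Fin h)) : (0 : Fin (h + 1)) ∉ S.map (Fin.succEmb h) := by
  intro h0
  obtain ⟨a, _, ha⟩ := Finset.mem_map.mp h0
  exact Fin.succ_ne_zero a ha

/-- The total weight of a homogeneous row is `2`. -/
theorem sum_hw (S : Finset (Fin h)) (hS2 : S.card ≤ 2) : (hS S).sum (hw S) = 2 := by
  unfold hS hw
  rcases Nat.lt_or_ge S.card 1 with h0 | h1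
  · have hc : S.card = 0 := by omega
    rw [if_pos (by omega), Finset.card_eq_zero.mp hc]
    simp
  · by_cases hle : S.card ≤ 1
    · have hc : S.card = 1 := by omega
      rw [if_pos hle, Finset.sum_insert (zero_not_mem_map_succ S), Finset.sum_const, Finset.card_map, hc]
      simp
    · have hc : S.card = 2 := by omega
      rw [if_neg hle, Finset.sum_const, Finset.card_map, hc]
      simp

/-- **At `P_0 = 0` a homogeneous entry is the segment-moment entry of the shifted table** `Q a = P (a+1)`. -/
theorem hom_entry_zero (P : Fin (h + 1) → Fin h → ℂ) (hP : ∀ c, P 0 c = 0) (S : Finset (Fin h)) (hS2 : S.card ≤ 2)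
    (T : Finset (Fin h)) : dirE P (hS S) (hw S) T = segE (fun a => P a.succ) S T := by
  rw [← dirE_one]
  unfold hS hw
  rcases Nat.lt_or_ge S.card 1 with h0 | h1
  · -- `S = ∅`: row `{0}` with weight 2 = `δ_{P_0} = δ_0`
    have hc : S = ∅ := Finset.card_eq_zero.mp (by omega)
    subst hc
    simp only [Finset.card_empty, Nat.zero_le, if_true, Finset.map_empty, insert_empty_eq]
    rw [dirE_singleton]
    by_cases hT : T = ∅
    · subst hT; simp [Cert.dirE_empty_col]
    · obtain ⟨c, hc⟩ := Finset.nonempty_iff_ne_empty.mpr hT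
      rw [Finset.prod_eq_zero hc (hP c), mul_zero, Cert.dirE_empty_row _ _ ⟨c, hc⟩]
  · by_cases hle : S.card ≤ 1
    · -- `S = {a}`: row `{0, a+1}` with the origin null
      obtain ⟨a, rfl⟩ := Finset.card_eq_one.mp (show S.card = 1 by omega)
      rw [if_pos hle, if_neg (by simp), Finset.map_singleton, dirE_singleton,
        show (Fin.succEmb h) a = a.succ from rfl, dirE_pair_null P _ T (fun c _ => hP c)]
    · -- `S = {a, b}`: relabel along `succ`
      rw [if_neg hle, if_neg (by omega), dirE_map_emb]
      rfl

/-- **The homogeneous matrix of an enumeration** `u` at a table of `h + 1` points. -/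
noncomputable def homMatrix (u : Fin r → Finset (Fin h)) (P : Fin (h + 1) → Fin h → ℂ) : Matrix (Fin r) (Fin r) ℂ :=
  Matrix.of fun i j => dirE P (hS (u i)) (hw (u i)) (benchCols h r j)

/-- **BRIDGE: homogeneous nonsingularity ⇒ segment mean-value nonsingularity** for the same enumeration: translate the table so that the
origin goes to `0` (determinant unchanged, `det_shiftT`), then read the pinned-origin matrix (`hom_entry_zero`). -/
theorem smv_of_hom (hr : r ≤ 2 ^ h) (u : Fin r → Finset (Fin h)) (hu2 : ∀ i, (u i).card ≤ 2) (P : Fin (h + 1) → Fin h → ℂ)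
    (hP : (homMatrix u P).det ≠ 0) :
    ∃ Q : Fin h → Fin h → ℂ, (Matrix.of fun i j : Fin r => segE Q (u i) (benchCols h r j)).det ≠ 0 := by
  set v : Fin h → ℂ := fun c => -P 0 c with hv
  refine ⟨fun a => shiftT P v a.succ, ?_⟩
  have h0 : ∀ c, shiftT P v 0 c = 0 := fun c => by simp [shiftT, hv]
  have e : (Matrix.of fun i j : Fin r => segE (fun a => shiftT P v a.succ) (u i) (benchCols h r j)) =
      Matrix.of fun i j : Fin r => dirE (shiftT P v) (hS (u i)) (hw (u i)) (benchCols h r j) := by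
    refine Matrix.ext fun i j => ?_
    rw [Matrix.of_apply, Matrix.of_apply, hom_entry_zero _ h0 _ (hu2 i)]
  rw [e, det_shiftT hr P v (fun i => hS (u i)) (fun i => hw (u i)) 2 (fun i => sum_hw _ (hu2 i))]
  exact hP

end Hom

/-! ## The list encoding of the homogeneous root, the typed node, and the arrow to the line's stub -/

section Node

variable {h r : ℕ}

/-- The homogeneous support lists of an enumeration (sorted point indices in `Fin (h+1)`). -/
def hEncL (u : Fin r → Finset (Fin h)) : List (List ℕ) :=
  List.ofFn fun i : Fin r => ((hS (u i)).sort (· ≤ ·)).map Fin.val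

/-- The homogeneous weight data of an enumeration: `(2, 1)` for the empty set, `(1, 1)` otherwise. -/
def hWL (u : Fin r → Finset (Fin h)) : List (ℕ × ℕ) :=
  List.ofFn fun i : Fin r => if (u i).card = 0 then (2, 1) else (1, 1)

/-- Reading the support lists back. -/
theorem hEncL_getD (u : Fin r → Finset (Fin h)) (i : Fin r) : (hEncL u).getD i [] = ((hS (u i)).sort (· ≤ ·)).map Fin.val := by
  unfold hEncL; rw [getD_ofFn _ _ i.2]

/-- Reading the weights back. -/
theorem hWL_getD (u : Fin r → Finset (Fin h)) (i : Fin r) : (hWL u).getD i (1, 1) = if (u i).card = 0 then (2, 1) else (1, 1) := by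
  unfold hWL; rw [getD_ofFn _ _ i.2]

/-- Decoding: the support finset of row `i` is the homogeneous row. -/
theorem Sof_hEncL (u : Fin r → Finset (Fin h)) (i : Fin r) : Cert.Sof (h + 1) ((hEncL u).getD i []) = hS (u i) := by
  ext a
  rw [hEncL_getD]
  simp only [Cert.Sof, Finset.mem_filter, Finset.mem_univ, true_and, List.mem_map, Finset.mem_sort]
  constructor
  · rintro ⟨b, hb, hba⟩
    rwa [← Fin.val_injective hba]
  · intro ha; exact ⟨a, ha, rfl⟩

/-- The homogeneous rows have size ≤ 2. -/
theorem card_hS (S : Finset (Fin h)) (hS2 : S.card ≤ 2) : (hS S).card ≤ 2 := by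
  unfold hS
  by_cases hle : S.card ≤ 1
  · rw [if_pos hle, Finset.card_insert_of_notMem (zero_not_mem_map_succ S), Finset.card_map]; omega
  · rw [if_neg hle, Finset.card_map]; exact hS2

/-- The encoding is well formed (`supOK`). -/
theorem hEncL_spec (u : Fin r → Finset (Fin h)) (hu2 : ∀ i, (u i).card ≤ 2) :
    ∀ i < r, ((hEncL u).getD i []).length ≤ 2 ∧ (∀ x ∈ (hEncL u).getD i [], x < h + 1) ∧ ((hEncL u).getD i []).Nodup := by
  intro i hi
  rw [hEncL_getD u ⟨i, hi⟩]
  refine ⟨?_, ?_, ?_⟩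
  · rw [List.length_map, Finset.length_sort]; exact card_hS _ (hu2 _)
  · intro x hx
    obtain ⟨a, _, rfl⟩ := List.mem_map.mp hx
    exact a.2
  · exact (Finset.sort_nodup _ _).map Fin.val_injective

/-- The encoded weights agree with `hw` on the support. -/
theorem wOf_hEncL (u : Fin r → Finset (Fin h)) (hu2 : ∀ i, (u i).card ≤ 2) (i : Fin r) {a : Fin (h + 1)} (ha : a ∈ hS (u i)) :
    Cert.wOf ((hEncL u).getD i []) (1, ((hWL u).getD i (1, 1)).1, ((hWL u).getD i (1, 1)).2) a = hw (u i) a := by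
  rw [hWL_getD]
  unfold hw
  by_cases h0 : (u i).card = 0
  · -- empty set: the row is `[0]`, weight 2
    have hrow : (hEncL u).getD i [] = [0] := by
      rw [hEncL_getD, hS, if_pos (by omega), Finset.card_eq_zero.mp h0, Finset.map_empty, insert_empty_eq,
        Finset.sort_singleton]; rfl
    have ha0 : a = 0 := by
      rw [hS, if_pos (by omega), Finset.card_eq_zero.mp h0, Finset.map_empty, insert_empty_eq, Finset.mem_singleton] at ha
      exact ha
    subst ha0
    rw [hrow, if_pos h0, if_pos h0]
    simp [Cert.wOf]
  · rw [if_neg h0, if_neg h0]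
    have ha' : a ∈ Cert.Sof (h + 1) ((hEncL u).getD i []) := by rw [Sof_hEncL]; exact ha
    exact Cert.wOf_one (hEncL_spec u hu2 i i.2).1 1 ha'

/-- **The matrix of the encoded homogeneous root is the homogeneous matrix.** -/
theorem rootInstW_hEncL_matrix (hr : r ≤ 2 ^ h) (u : Fin r → Finset (Fin h)) (hu2 : ∀ i, (u i).card ≤ 2)
    (P : Fin (h + 1) → Fin h → ℂ) : (Cert.rootInstW (hEncL u) (hWL u) r).matrix (h + 1) h r P = homMatrix u P := by
  rw [Cert.rootInstW_matrix _ _ hr]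
  refine Matrix.ext fun i j => ?_
  rw [Matrix.of_apply, homMatrix, Matrix.of_apply, Sof_hEncL]
  exact Cert.dirE_congr_weights P _ _ fun a ha => wOf_hEncL u hu2 i ha

/-- **TYPED NODE (slot #7 of the line's registry) — «every enumeration of the subsets of size ≤ 2 of `Fin h` has a SPLIT CERTIFICATE for
its homogeneous root».**  Each instance is a finite search; the seat's generator finds top-only triangular certificates for the canonical
enumeration at every `h ≤ 12` (kernel-checked in `…SplitCertInstances*`), val-np-p4 g23's for every `h ≤ 31` in the same model; «Conjecture C»
(memo g23 §13: completeness of one-coordinate splits) + HAAR would imply it.  CHEAPEST FALSIFIER: one height at which an exhaustive search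
over vertex orders finds no certificate (none known). -/
def Stmt.splitCertH : Prop :=
  ∀ (h r : ℕ) (u : Fin r → Finset (Fin h)), Function.Injective u → (∀ i, (u i).card ≤ 2) →
    (∀ S : Finset (Fin h), S.card ≤ 2 → ∃ i, u i = S) →
    ∃ ls : List Cert.Level, Cert.check h r ls (Cert.rootInstW (hEncL u) (hWL u) r) = true

/-- **ARROW (kernel): a certificate for the homogeneous root of an enumeration gives segment mean-value unisolvence for it.** -/
theorem smv_of_check (u : Fin r → Finset (Fin h)) (hu : Function.Injective u) (hu2 : ∀ i, (u i).card ≤ 2)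
    (hsurj : ∀ S : Finset (Fin h), S.card ≤ 2 → ∃ i, u i = S) (ls : List Cert.Level)
    (hc : Cert.check h r ls (Cert.rootInstW (hEncL u) (hWL u) r) = true) :
    ∃ P : Fin h → Fin h → ℂ,
      (Matrix.of fun i j : Fin r =>
        ∑ g : (↥(benchCols h r j) → ↥(u i)), (∏ c : ↥(benchCols h r j), P (g c) c) *
          ∏ a : ↥(u i), ((Finset.univ.filter fun c : ↥(benchCols h r j) => g c = a).card.factorial : ℂ)).det ≠ 0 := by
  have hr : r ≤ 2 ^ h := (eq_windowStart_of_enumeration u hu hu2 hsurj) ▸ windowStart_succ_le_two_pow h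
  obtain ⟨P, hP⟩ := Cert.exists_table_of_check (p := h + 1) (k := h) ls _ (Cert.supOK_of_spec (hEncL_spec u hu2)) hc
  rw [rootInstW_hEncL_matrix hr u hu2] at hP
  exact smv_of_hom hr u hu2 P hP

/-- **ARROW (kernel): the node implies the line's registered stub `stub_segmentMeanValue`** (`∀ h, SegmentMeanValueAt h`, unfolded
verbatim as in `…ChowBenchmarkPairsHaar.segmentMeanValue_of_haar`). -/
theorem segmentMeanValue_of_splitCertH (H : Stmt.splitCertH) : ∀ h : ℕ,
    ∀ (r : ℕ) (u : Fin r → Finset (Fin h)), Function.Injective u → (∀ i, (u i).card ≤ 2) →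
      (∀ S : Finset (Fin h), S.card ≤ 2 → ∃ i, u i = S) →
      ∃ P : Fin h → Fin h → ℂ,
        (Matrix.of fun i j : Fin r =>
          ∑ g : (↥(benchCols h r j) → ↥(u i)), (∏ c : ↥(benchCols h r j), P (g c) c) *
            ∏ a : ↥(u i),
              ((Finset.univ.filter fun c : ↥(benchCols h r j) => g c = a).card.factorial : ℂ)).det ≠ 0 := by
  intro h r u hu hu2 hsurj
  obtain ⟨ls, hls⟩ := H h r u hu hu2 hsurj
  exact smv_of_check u hu hu2 hsurj ls hls

end Node

end Summit.ValiantsHypothesis.ValiantsHypothesis.Theorems.BarrierLever.ChowBenchmarkSplit
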